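import Summits.Ventures.Crystal3D.Theorems.StickyWulffConstantTextureLiminfCellFluxMix
import HarnessLib

/-!
# The cell inequality from a WEIGHTED line count (by-name glue for the per-plate family mixtures)
# (LAYER-FLUX chain, MAX ruling made precise; crux `TextureLiminf`, stmt-Ventures-19483; cf-p1 ROUTE.md §86(81b) (xxxvii′))

HONEST FRAMING. Venture `Summits/Ventures/Crystal3D` (cell `crystal3d-full`), helper `--supports` the crux
`TextureLiminf` (stmt-Ventures-19483) of `route-Ventures-StickyWulffConstant`, registered line `TexShadow`.  Rung credit
only; F-C1 not moved.  NOT the wall law; not lane G's walker families.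

`cell_charge_le_lines_mix` (`…CellFluxMix`) bounds twice the charge of a MIX-dominated table by the weighted line count
`a₁#T₁ + a₂#T₂ + b₁#T₃ + b₂#T₄ + 160(R₀+9)(1+h)ρ`.  This file adds the inner launch disc and the by-name glue to the cell
inequality, exactly parallel to `…LineCountGlueComb` (weights `(1,1,1,1)`) and `…LineCountGlue` (weights `(1,0,1,0)`):

* `cell_charge_le_lines_mix_margin` — windows of lateral radius `ρ − m`, `+ 36·m·ρ`;
* **`bilayerWallAt_of_lineCount_mix`** — for weights in `[0,1]` and every mix-dominated `c ≥ 0` (`1/4 ≤ τ₀`, `R₀ ≥ 3`), the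
  F4-shaped hypothesis with the WEIGHTED count `a₁#T₁ + a₂#T₂ + b₁#T₃ + b₂#T₄ + 36mρ ≤ Σ_PAY(12 − deg) + C_w(1+h)ρ` implies
  `BilayerWallAt ((C_w + 160(R₀+9) + 3456 + 1152(R₀+1))/2) R₀ σ₁ σ₂ L₁ L₂ s₁ s₂ c`.  Lane G discharges the weighted count from its
  four family-PAIR certificates (`λμ`-expansion, see `…CellFluxMix`); at a corner `a + b = 1`, `a, b ∈ {0,1}` per plate this is ONE
  pair certificate.
WHAT THIS IS NOT: not F4 for the row family (its launch / off-reach predicates are lane G's to name); F-C1 not moved.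
-/

noncomputable section

namespace Summit.Ventures.Crystal3D.Theorems

open MeasureTheory Set
open scoped ENNReal InnerProductSpace
open Literature.MathematicalPhysics.StatisticalMechanics (IsHaggSeq triangularVec₁ triangularVec₂)
open Summit.Ventures.Crystal3D.Cruxes.TextureLiminf.TexShadow (E3 e₃ cyl stacking laySlab bilayerRise PlateLaunchable plateFlux
  layerFlux layerFlux_nonneg layerFlux_le_sqrt_two MixFluxDominated BilayerWallAt)

set_option maxHeartbeats 400000 in
/-- **The weighted cell bound with an inner launch disc** (windows of lateral radius `ρ − m`, `+ 36·m·ρ`). -/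
theorem cell_charge_le_lines_mix_margin {σ₁ σ₂ : ℤ → ℤ} (hσ₁ : IsHaggSeq σ₁) (hσ₂ : IsHaggSeq σ₂)
    (L₁ L₂ : E3 ≃ₗᵢ[ℝ] E3) (s₁ s₂ : E3) (τ₀ R₀ h ρ : ℝ) (hτ₀ : 1 / 4 ≤ τ₀) (hR₀ : 1 ≤ R₀) (hh : 0 ≤ h) (hρ : 0 ≤ ρ)
    {a₁ b₁ a₂ b₂ : ℝ} (ha₁ : 0 ≤ a₁) (ha₁1 : a₁ ≤ 1) (hb₁ : 0 ≤ b₁) (hb₁1 : b₁ ≤ 1) (ha₂ : 0 ≤ a₂) (ha₂1 : a₂ ≤ 1)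
    (hb₂ : 0 ≤ b₂) (hb₂1 : b₂ ≤ 1)
    (c : ℤ → ℤ → ℝ) (hc0 : ∀ i j, 0 ≤ c i j) (hdom : MixFluxDominated τ₀ a₁ b₁ a₂ b₂ L₁ σ₁ L₂ σ₂ c)
    {step₁ : ℤ → E3} (hsel₁ : IsZigSelector L₁ σ₁ e₃ step₁) {step₂ : ℤ → E3} (hsel₂ : IsZigSelector L₂ σ₂ (-e₃) step₂)
    (m : ℝ) (hm : 0 ≤ m) (T₁ T₂ : Finset (Fin 2 → ℤ)) (T₃ T₄ : Finset (ℤ × ℤ))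
    (hT₁ : ∀ t : Fin 2 → ℤ, (∃ k : ℤ,
        -R₀ - 4 ≤ (L₁ (zigVertexS step₁ k + ((t 0 : ℝ) • triangularVec₁ 1 + (t 1 : ℝ) • triangularVec₂ 1)) + s₁) 2 ∧
        (L₁ (zigVertexS step₁ k + ((t 0 : ℝ) • triangularVec₁ 1 + (t 1 : ℝ) • triangularVec₂ 1)) + s₁) 2 ≤ -R₀ - 3 ∧
        Real.sqrt ((L₁ (zigVertexS step₁ k + ((t 0 : ℝ) • triangularVec₁ 1 + (t 1 : ℝ) • triangularVec₂ 1)) + s₁) 0 ^ 2 +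
          (L₁ (zigVertexS step₁ k + ((t 0 : ℝ) • triangularVec₁ 1 + (t 1 : ℝ) • triangularVec₂ 1)) + s₁) 1 ^ 2) ≤ ρ - m) →
        t ∈ T₁)
    (hT₂ : ∀ t : Fin 2 → ℤ, (∃ k : ℤ,
        h + R₀ + 3 ≤ (L₂ (zigVertexS step₂ k + ((t 0 : ℝ) • triangularVec₁ 1 + (t 1 : ℝ) • triangularVec₂ 1)) + s₂) 2 ∧
        (L₂ (zigVertexS step₂ k + ((t 0 : ℝ) • triangularVec₁ 1 + (t 1 : ℝ) • triangularVec₂ 1)) + s₂) 2 ≤ h + R₀ + 4 ∧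
        Real.sqrt ((L₂ (zigVertexS step₂ k + ((t 0 : ℝ) • triangularVec₁ 1 + (t 1 : ℝ) • triangularVec₂ 1)) + s₂) 0 ^ 2 +
          (L₂ (zigVertexS step₂ k + ((t 0 : ℝ) • triangularVec₁ 1 + (t 1 : ℝ) • triangularVec₂ 1)) + s₂) 1 ^ 2) ≤ ρ - m) →
        t ∈ T₂)
    (hT₃ : ∀ kj : ℤ × ℤ, (∃ i : ℤ,
        -R₀ - 4 ≤ (L₁ (layerSite σ₁ L₁ e₃ kj.1 i kj.2) + s₁) 2 ∧ (L₁ (layerSite σ₁ L₁ e₃ kj.1 i kj.2) + s₁) 2 ≤ -R₀ - 3 ∧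
        Real.sqrt ((L₁ (layerSite σ₁ L₁ e₃ kj.1 i kj.2) + s₁) 0 ^ 2 + (L₁ (layerSite σ₁ L₁ e₃ kj.1 i kj.2) + s₁) 1 ^ 2) ≤
          ρ - m) → kj ∈ T₃)
    (hT₄ : ∀ kj : ℤ × ℤ, (∃ i : ℤ,
        h + R₀ + 3 ≤ (L₂ (layerSite σ₂ L₂ (-e₃) kj.1 i kj.2) + s₂) 2 ∧
        (L₂ (layerSite σ₂ L₂ (-e₃) kj.1 i kj.2) + s₂) 2 ≤ h + R₀ + 4 ∧
        Real.sqrt ((L₂ (layerSite σ₂ L₂ (-e₃) kj.1 i kj.2) + s₂) 0 ^ 2 +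
          (L₂ (layerSite σ₂ L₂ (-e₃) kj.1 i kj.2) + s₂) 1 ^ 2) ≤ ρ - m) → kj ∈ T₄) :
    2 * ∑' ij : ℤ × ℤ, c ij.1 ij.2 * (volume (wallSlice ρ ∩ laySlab L₁ s₁ ij.1 ∩ laySlab L₂ s₂ ij.2)).toReal ≤
      a₁ * (T₁.card : ℝ) + a₂ * T₂.card + b₁ * T₃.card + b₂ * T₄.card + 160 * (R₀ + 9) * (1 + h) * ρ + 36 * m * ρ := by
  have he₃ : ‖(e₃ : E3)‖ = 1 := by rw [e₃, PiLp.norm_single, norm_one]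
  have hne₃ : ‖(-e₃ : E3)‖ = 1 := by rw [norm_neg, he₃]
  have hs2 : 0 ≤ Real.sqrt 2 := Real.sqrt_nonneg 2
  have hw : ∀ {a x : ℝ}, a ≤ 1 → 0 ≤ x → x ≤ Real.sqrt 2 → a * x ≤ Real.sqrt 2 := fun ha1 hx hxB =>
    (mul_le_mul_of_nonneg_right ha1 hx).trans (by rw [one_mul]; exact hxB)
  have hcB : ∀ i j, c i j ≤ 2 * Real.sqrt 2 := fun i j => by
    have h1 := hw ha₁1 (plateFlux_nonneg τ₀ L₁ σ₁ he₃ i) (plateFlux_le_sqrt_two τ₀ L₁ σ₁ he₃ i)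
    have h2 := hw ha₂1 (plateFlux_nonneg τ₀ L₂ σ₂ hne₃ j) (plateFlux_le_sqrt_two τ₀ L₂ σ₂ hne₃ j)
    have h3 := hw hb₁1 (layerFlux_nonneg τ₀ L₁ e₃) (layerFlux_le_sqrt_two τ₀ L₁ he₃)
    have h4 := hw hb₂1 (layerFlux_nonneg τ₀ L₂ (-e₃)) (layerFlux_le_sqrt_two τ₀ L₂ hne₃)
    have h5 := hdom i j
    linarith only [h1, h2, h3, h4, h5]
  have h418 := four_sqrt_two_pi_le
  have hπ0 := Real.pi_pos.le
  have hT0 : (0 : ℝ) ≤ a₁ * (T₁.card : ℝ) + a₂ * T₂.card + b₁ * T₃.card + b₂ * T₄.card := by positivity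
  have hR9 : (0 : ℝ) ≤ 160 * (R₀ + 9) * (1 + h) * ρ := by
    have : 0 ≤ R₀ + 9 := by linarith
    positivity
  have hSfin : ∀ r, 0 ≤ r → volume (wallSlice r) ≠ ⊤ := fun r hr => by rw [volume_wallSlice r hr]; exact ENNReal.ofReal_ne_top
  by_cases hsmall : ρ ≤ m
  · -- the whole slice is margin
    have h1 := two_charge_le_const L₁ L₂ s₁ s₂ c (2 * Real.sqrt 2) hc0 hcB (wallSlice ρ) (measurableSet_wallSlice ρ) (hSfin ρ hρ)
    rw [volume_wallSlice ρ hρ, ENNReal.toReal_ofReal (by positivity)] at h1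
    have h2 : Real.pi * ρ ^ 2 ≤ Real.pi * (ρ * m) := mul_le_mul_of_nonneg_left (by nlinarith) hπ0
    have h3 : 2 * (2 * Real.sqrt 2) * (Real.pi * (ρ * m)) ≤ 36 * m * ρ := by
      have : 2 * (2 * Real.sqrt 2) * (Real.pi * (ρ * m)) = (4 * Real.sqrt 2 * Real.pi) * (m * ρ) := by ring
      rw [this]
      nlinarith [mul_nonneg hm hρ]
    nlinarith [mul_le_mul_of_nonneg_left h2 (by positivity : 0 ≤ 2 * (2 * Real.sqrt 2))]
  push Not at hsmall
  set ρ' : ℝ := ρ - m with hρ'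
  have hρ'0 : 0 ≤ ρ' := by rw [hρ']; linarith
  have hρ'ρ : ρ' ≤ ρ := by rw [hρ']; linarith
  -- the inner slice: the cell bound at radius `ρ'`
  have hinner := cell_charge_le_lines_mix hσ₁ hσ₂ L₁ L₂ s₁ s₂ τ₀ R₀ h ρ' hτ₀ hR₀ hh hρ'0 ha₁ ha₁1 hb₁ hb₁1 ha₂ ha₂1 hb₂ hb₂1
    c hc0 hdom hsel₁ hsel₂ T₁ T₂ T₃ T₄ hT₁ hT₂ hT₃ hT₄
  -- split the charge into inner slice and margin annulus
  set S : Set E3 := wallSlice ρ with hS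
  set S' : Set E3 := wallSlice ρ' with hS'
  set ann : Set E3 := S \ S' with hann
  have hS'S : S' ⊆ S := wallSlice_mono hρ'ρ hρ'0
  have hSm : MeasurableSet S := measurableSet_wallSlice ρ
  have hS'm : MeasurableSet S' := measurableSet_wallSlice ρ'
  have hannm : MeasurableSet ann := hSm.diff hS'm
  have hannfin : volume ann ≠ ⊤ := ne_top_of_le_ne_top (hSfin ρ hρ) (measure_mono Set.sdiff_subset)
  set f : Set E3 → ℤ × ℤ → ℝ := fun X ij => c ij.1 ij.2 * (volume (X ∩ laySlab L₁ s₁ ij.1 ∩ laySlab L₂ s₂ ij.2)).toReal with hf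
  have hsplit : ∀ ij, f S ij = f S' ij + f ann ij := by
    intro ij
    simp only [hf]
    have hset : S ∩ laySlab L₁ s₁ ij.1 ∩ laySlab L₂ s₂ ij.2 =
        (S' ∩ laySlab L₁ s₁ ij.1 ∩ laySlab L₂ s₂ ij.2) ∪ (ann ∩ laySlab L₁ s₁ ij.1 ∩ laySlab L₂ s₂ ij.2) := by
      rw [← Set.union_inter_distrib_right, ← Set.union_inter_distrib_right, hann, Set.union_sdiff_cancel hS'S]
    have hdisj : Disjoint (S' ∩ laySlab L₁ s₁ ij.1 ∩ laySlab L₂ s₂ ij.2) (ann ∩ laySlab L₁ s₁ ij.1 ∩ laySlab L₂ s₂ ij.2) :=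
      (Set.disjoint_sdiff_right).mono (Set.inter_subset_left.trans Set.inter_subset_left)
        (Set.inter_subset_left.trans Set.inter_subset_left)
    rw [hset, measure_union hdisj ((hannm.inter (measurableSet_laySlab L₁ s₁ _)).inter (measurableSet_laySlab L₂ s₂ _)),
      ENNReal.toReal_add (ne_top_of_le_ne_top (hSfin ρ' hρ'0) (measure_mono (Set.inter_subset_left.trans Set.inter_subset_left)))
        (ne_top_of_le_ne_top hannfin (measure_mono (Set.inter_subset_left.trans Set.inter_subset_left))), mul_add]
  have hsumS' := summable_charge L₁ L₂ s₁ s₂ c (2 * Real.sqrt 2) hc0 hcB S' hS'm (hSfin ρ' hρ'0)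
  have hsumA := summable_charge L₁ L₂ s₁ s₂ c (2 * Real.sqrt 2) hc0 hcB ann hannm hannfin
  have hQ : ∑' ij, f S ij = ∑' ij, f S' ij + ∑' ij, f ann ij := by
    rw [← hsumS'.tsum_add hsumA]; exact tsum_congr hsplit
  -- the margin annulus at `2√2` per unit volume
  have hA := two_charge_le_const L₁ L₂ s₁ s₂ c (2 * Real.sqrt 2) hc0 hcB ann hannm hannfin
  have hvolann : (volume ann).toReal = Real.pi * ρ ^ 2 - Real.pi * ρ' ^ 2 := by
    have hu : volume S = volume S' + volume ann := by
      rw [← measure_union (Set.disjoint_sdiff_right) hannm, Set.union_sdiff_cancel hS'S]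
    rw [hS, hS', volume_wallSlice ρ hρ, volume_wallSlice ρ' hρ'0] at hu
    have h1 : volume ann = ENNReal.ofReal (Real.pi * ρ ^ 2) - ENNReal.ofReal (Real.pi * ρ' ^ 2) :=
      (ENNReal.sub_eq_of_eq_add_rev ENNReal.ofReal_ne_top hu).symm
    rw [h1, ← ENNReal.ofReal_sub _ (by positivity), ENNReal.toReal_ofReal]
    nlinarith [mul_le_mul_of_nonneg_left (pow_le_pow_left₀ hρ'0 hρ'ρ 2) hπ0]
  have hannle : (volume ann).toReal ≤ 2 * Real.pi * ρ * m := by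
    rw [hvolann, hρ']; nlinarith [mul_nonneg hπ0 (sq_nonneg m)]
  have h1 : 2 * ∑' ij, f S' ij ≤
      a₁ * (T₁.card : ℝ) + a₂ * T₂.card + b₁ * T₃.card + b₂ * T₄.card + 160 * (R₀ + 9) * (1 + h) * ρ' := by
    simp only [hf] at hinner ⊢; exact hinner
  have h2 : 2 * ∑' ij, f ann ij ≤ 2 * (2 * Real.sqrt 2) * (2 * Real.pi * ρ * m) := by
    simp only [hf] at hA ⊢
    exact hA.trans (mul_le_mul_of_nonneg_left hannle (by positivity))
  have hconst : 2 * (2 * Real.sqrt 2) * (2 * Real.pi * ρ * m) ≤ 36 * m * ρ := by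
    have : 2 * (2 * Real.sqrt 2) * (2 * Real.pi * ρ * m) = 2 * ((4 * Real.sqrt 2 * Real.pi) * (m * ρ)) := by ring
    rw [this]; nlinarith [mul_nonneg hm hρ]
  have hρ'le : 160 * (R₀ + 9) * (1 + h) * ρ' ≤ 160 * (R₀ + 9) * (1 + h) * ρ := by
    have : 0 ≤ 160 * (R₀ + 9) * (1 + h) := by
      have : 0 ≤ R₀ + 9 := by linarith
      positivity
    exact mul_le_mul_of_nonneg_left hρ'ρ this
  have hmain : 2 * ∑' ij, f S ij ≤
      a₁ * (T₁.card : ℝ) + a₂ * T₂.card + b₁ * T₃.card + b₂ * T₄.card + 160 * (R₀ + 9) * (1 + h) * ρ + 36 * m * ρ := by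
    rw [hQ, mul_add]; linarith
  simp only [hf] at hmain
  exact hmain

/-- **The weighted F4-shaped deliverable ⇒ the cell inequality for MIX-dominated tables** (`R₀ ≥ 3`, weights in `[0,1]`). -/
theorem bilayerWallAt_of_lineCount_mix {σ₁ σ₂ : ℤ → ℤ} (hσ₁ : IsHaggSeq σ₁) (hσ₂ : IsHaggSeq σ₂)
    (L₁ L₂ : E3 ≃ₗᵢ[ℝ] E3) (s₁ s₂ : E3) (τ₀ R₀ C_w : ℝ) (hτ₀ : 1 / 4 ≤ τ₀) (hR₀ : 3 ≤ R₀)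
    {a₁ b₁ a₂ b₂ : ℝ} (ha₁ : 0 ≤ a₁) (ha₁1 : a₁ ≤ 1) (hb₁ : 0 ≤ b₁) (hb₁1 : b₁ ≤ 1) (ha₂ : 0 ≤ a₂) (ha₂1 : a₂ ≤ 1)
    (hb₂ : 0 ≤ b₂) (hb₂1 : b₂ ≤ 1)
    (c : ℤ → ℤ → ℝ) (hc0 : ∀ i j, 0 ≤ c i j) (hdom : MixFluxDominated τ₀ a₁ b₁ a₂ b₂ L₁ σ₁ L₂ σ₂ c)
    {step₁ : ℤ → E3} (hsel₁ : IsZigSelector L₁ σ₁ e₃ step₁) {step₂ : ℤ → E3} (hsel₂ : IsZigSelector L₂ σ₂ (-e₃) step₂)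
    (hF4 : ∀ h : ℝ, 0 ≤ h → ∀ ρ : ℝ, R₀ ≤ ρ → ∀ X P₁ P₂ : Finset E3,
      (∀ p ∈ X, ∀ q ∈ X, p ≠ q → 1 ≤ dist p q) → P₁ ⊆ X → P₂ ⊆ X \ P₁ → (∀ p ∈ X, p ∈ cyl R₀ h ρ) →
      (∀ p, p ∈ P₁ ↔ (p ∈ stacking L₁ s₁ σ₁ ∧ -(2 * R₀) ≤ p 2 ∧ p 2 ≤ -R₀ ∧ p 0 ^ 2 + p 1 ^ 2 ≤ ρ ^ 2)) →
      (∀ p, p ∈ P₂ ↔ (p ∈ stacking L₂ s₂ σ₂ ∧ h + R₀ ≤ p 2 ∧ p 2 ≤ h + 2 * R₀ ∧ p 0 ^ 2 + p 1 ^ 2 ≤ ρ ^ 2)) →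
      ∃ (m : ℝ) (T₁ T₂ : Finset (Fin 2 → ℤ)) (T₃ T₄ : Finset (ℤ × ℤ)), 0 ≤ m ∧
        (∀ t : Fin 2 → ℤ, (∃ k : ℤ,
          -R₀ - 4 ≤ (L₁ (zigVertexS step₁ k + ((t 0 : ℝ) • triangularVec₁ 1 + (t 1 : ℝ) • triangularVec₂ 1)) + s₁) 2 ∧
          (L₁ (zigVertexS step₁ k + ((t 0 : ℝ) • triangularVec₁ 1 + (t 1 : ℝ) • triangularVec₂ 1)) + s₁) 2 ≤ -R₀ - 3 ∧
          Real.sqrt ((L₁ (zigVertexS step₁ k + ((t 0 : ℝ) • triangularVec₁ 1 + (t 1 : ℝ) • triangularVec₂ 1)) + s₁) 0 ^ 2 +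
            (L₁ (zigVertexS step₁ k + ((t 0 : ℝ) • triangularVec₁ 1 + (t 1 : ℝ) • triangularVec₂ 1)) + s₁) 1 ^ 2) ≤ ρ - m) →
          t ∈ T₁) ∧
        (∀ t : Fin 2 → ℤ, (∃ k : ℤ,
          h + R₀ + 3 ≤ (L₂ (zigVertexS step₂ k + ((t 0 : ℝ) • triangularVec₁ 1 + (t 1 : ℝ) • triangularVec₂ 1)) + s₂) 2 ∧
          (L₂ (zigVertexS step₂ k + ((t 0 : ℝ) • triangularVec₁ 1 + (t 1 : ℝ) • triangularVec₂ 1)) + s₂) 2 ≤ h + R₀ + 4 ∧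
          Real.sqrt ((L₂ (zigVertexS step₂ k + ((t 0 : ℝ) • triangularVec₁ 1 + (t 1 : ℝ) • triangularVec₂ 1)) + s₂) 0 ^ 2 +
            (L₂ (zigVertexS step₂ k + ((t 0 : ℝ) • triangularVec₁ 1 + (t 1 : ℝ) • triangularVec₂ 1)) + s₂) 1 ^ 2) ≤ ρ - m) →
          t ∈ T₂) ∧
        (∀ kj : ℤ × ℤ, (∃ i : ℤ,
          -R₀ - 4 ≤ (L₁ (layerSite σ₁ L₁ e₃ kj.1 i kj.2) + s₁) 2 ∧ (L₁ (layerSite σ₁ L₁ e₃ kj.1 i kj.2) + s₁) 2 ≤ -R₀ - 3 ∧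
          Real.sqrt ((L₁ (layerSite σ₁ L₁ e₃ kj.1 i kj.2) + s₁) 0 ^ 2 + (L₁ (layerSite σ₁ L₁ e₃ kj.1 i kj.2) + s₁) 1 ^ 2) ≤
            ρ - m) → kj ∈ T₃) ∧
        (∀ kj : ℤ × ℤ, (∃ i : ℤ,
          h + R₀ + 3 ≤ (L₂ (layerSite σ₂ L₂ (-e₃) kj.1 i kj.2) + s₂) 2 ∧
          (L₂ (layerSite σ₂ L₂ (-e₃) kj.1 i kj.2) + s₂) 2 ≤ h + R₀ + 4 ∧
          Real.sqrt ((L₂ (layerSite σ₂ L₂ (-e₃) kj.1 i kj.2) + s₂) 0 ^ 2 +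
            (L₂ (layerSite σ₂ L₂ (-e₃) kj.1 i kj.2) + s₂) 1 ^ 2) ≤ ρ - m) → kj ∈ T₄) ∧
        a₁ * (T₁.card : ℝ) + a₂ * T₂.card + b₁ * T₃.card + b₂ * T₄.card + 36 * m * ρ ≤
          (∑ y ∈ X.filter (fun y => (X.filter fun q => dist y q = 1).card ≠ 12 ∧ -R₀ - 2 ≤ y 2 ∧ y 2 ≤ h + R₀ + 2),
            ((12 : ℝ) - ((X.filter fun q => dist y q = 1).card : ℝ))) + C_w * (1 + h) * ρ) :
    BilayerWallAt ((C_w + 160 * (R₀ + 9) + 3456 + 1152 * (R₀ + 1)) / 2) R₀ σ₁ σ₂ L₁ L₂ s₁ s₂ c := by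
  classical
  have hR₀1 : 1 ≤ R₀ := by linarith
  refine bilayerWallAt_of_payerBound hσ₁ hσ₂ L₁ L₂ s₁ s₂ R₀ (C_w + 160 * (R₀ + 9)) hR₀ c ?_
  intro h hh ρ hρ X P₁ P₂ hX hP₁X hP₂X hcell hP₁ hP₂
  obtain ⟨m, T₁, T₂, T₃, T₄, hm, hT₁, hT₂, hT₃, hT₄, hcount⟩ := hF4 h hh ρ hρ X P₁ P₂ hX hP₁X hP₂X hcell hP₁ hP₂
  have hρ0 : 0 ≤ ρ := by linarith
  have hcellbound := cell_charge_le_lines_mix_margin hσ₁ hσ₂ L₁ L₂ s₁ s₂ τ₀ R₀ h ρ hτ₀ hR₀1 hh hρ0 ha₁ ha₁1 hb₁ hb₁1 ha₂ ha₂1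
    hb₂ hb₂1 c hc0 hdom hsel₁ hsel₂ m hm T₁ T₂ T₃ T₄ hT₁ hT₂ hT₃ hT₄
  have hset : ({q : E3 | 0 ≤ q 2 ∧ q 2 ≤ 1 ∧ q 0 ^ 2 + q 1 ^ 2 ≤ ρ ^ 2} : Set E3) = wallSlice ρ := rfl
  rw [hset]
  have hsplit : (C_w + 160 * (R₀ + 9)) * (1 + h) * ρ = C_w * (1 + h) * ρ + 160 * (R₀ + 9) * (1 + h) * ρ := by ring
  rw [hsplit]
  linarith

end Summit.Ventures.Crystal3D.Theorems

end
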